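import Summits.ResolutionOfSingularities.ResolutionOfSingularities.Theorems.FrobeniusClosingPatchingRelPerfectConeDepthConeChartThree
import Summits.ResolutionOfSingularities.ResolutionOfSingularities.Theorems.FrobeniusClosingPatchingRelPerfectConeDepthFibreCharts
import HarnessLib

/-!
# Crux `PatchingRelPerfect` (stmt-ResolutionOfSingularities-16161), chain W5.2 — rung «r-cone-ℓ», scheme level II: THE VERTEX FIBRE
# THEOREM — blowing up the vertex of the quadric cone host in a regular fourfold

[OURS · L1 W5.2 · rung tool] Replaces the role of NO printed item; NOT a statement of the manuscript under review; fact-free,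
any characteristic, any residue field.  AI-written (AI review is weaker than expert review).

Setting (`vertex_fibre`): `σ : X' ⟶ X` a blowing up along `J` (`IsBlowup σ J`) with `J_z = 𝔪_z` at a point `z` where `𝒪_{X,z}` is
regular of dimension `4` with a regular system of parameters `c₀, c₁, c₂, c₃`; two ideal sheaves `𝓗` ("host", the quadric cone:
`𝓗_z = (c₁c₂ + c₃²)`) and `G` ("old carrier": `G_z = (c₀)`).  Conclusion: there is a point `z'` over `z` — the NEW VERTEX, the
vertex prime `(φc₀, e₁, e₂, e₃)` of the chart `D₊(c₀t)` — such that
* at `z'`: `𝒪_{X',z'}` is regular of dimension `4` with a regular system of parameters `c'` in which `(J𝒪_{X'})_{z'} = (c'₀)`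
  (exceptional divisor), the weight-`2` controlled transform of `𝓗` is `(c'₁c'₂ + c'₃²)` (a cone again) and the strict (= weight-`1`
  controlled) transform of `G` is the unit ideal (`vertexFibre_vertex`, from the local algebra `coneVertex`);
* at every other point `x'` over `z` the list `[σᶜ(𝓗,2), J𝒪_{X'}, σᶜ(G,1)]` has simple normal crossings at `x'`
  (`DepthSNC.SNCWithAt … ⊤ x'`; `sncWithAt_chart_zero/linear/three`, from `coneChart_zero/linear/three` fed through
  `sncWithAt_of_adapted`).
Every point over `z` lies on one of the four charts `Spec B_j → X'` (`exists_charts_over`), on which `𝒪_{X',x'} = (B_j)_w`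
(`exists_stalk_presentation`) and the stalk dictionary of `…ConeDepthFibreCharts` computes the three stalks
(`offVertex_presentation`).  This is the engine of the vertex-blowup ladder for the rung «r-cone-ℓ» (`(c₁c₂ + c₃²) + 𝔪^{ℓ+2} ∈ 𝒞`):
each rung step blows up the current vertex, and this theorem supplies the new local state at the new vertex and simple normal
crossings everywhere else on the new exceptional divisor.
-/

set_option linter.dupNamespace false

noncomputable section

open CategoryTheory CategoryTheory.Limits AlgebraicGeometry TopologicalSpace IsLocalRing
open Literature.AlgebraicGeometry.Resolution
open Scheme.IdealSheafData

namespace Summit.ResolutionOfSingularities.ResolutionOfSingularities.Theorems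

universe u

namespace ConeDepth

/-! ## §6 THE VERTEX FIBRE THEOREM: blowing up a vertex of the cone host in a regular fourfold -/

section VertexFibre

variable {X' X : Scheme.{u}} {σ : X' ⟶ X} {J : X.IdealSheafData}

/-- Points of a chart over a prime lying over `𝔪_z` lie over `z`. [folklore] -/
theorem apply_chart_eq_of_comap {z : X} {k : ℕ} {c : Fin k → X.presheaf.stalk z} {j : Fin k}
    {q : Spec (.of (chartRing c j)) ⟶ X'} (hq : q ≫ σ = Spec.map (CommRingCat.ofHom (chartBase c j)) ≫ X.fromSpecStalk z)
    (w : PrimeSpectrum (chartRing c j)) (hw : w.asIdeal.comap (chartBase c j) = maximalIdeal (X.presheaf.stalk z)) :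
    σ (q w) = z := by
  have h1 : σ (q w) = (Spec.map (CommRingCat.ofHom (chartBase c j)) ≫ X.fromSpecStalk z) w := by
    rw [← hq]; rfl
  have h2 : Spec.map (CommRingCat.ofHom (chartBase c j)) w = IsLocalRing.closedPoint (X.presheaf.stalk z) := by
    rw [Spec.map_apply]
    exact PrimeSpectrum.ext hw
  rw [h1, Scheme.Hom.comp_apply, h2, Scheme.fromSpecStalk_closedPoint]

variable (hσ : IsBlowup σ J) (z : X) (c : Fin 4 → X.presheaf.stalk z) [IsRegularLocalRing (X.presheaf.stalk z)]
  (hz𝔪 : Ideal.span (Set.range c) = maximalIdeal (X.presheaf.stalk z))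
  (hd : (maximalIdeal (X.presheaf.stalk z)).spanFinrank = 4)
  (hJ : stalkIdeal J z = maximalIdeal (X.presheaf.stalk z)) (𝓗 G : X.IdealSheafData)
  (h𝓗 : stalkIdeal 𝓗 z = Ideal.span {c 1 * c 2 + c 3 ^ 2}) (hG : stalkIdeal G z = Ideal.span {c 0})
  (q : (j : Fin 4) → (Spec (.of (chartRing c j)) ⟶ X'))
  (hqσ : ∀ j, q j ≫ σ = Spec.map (CommRingCat.ofHom (chartBase c j)) ≫ X.fromSpecStalk z)
  (hqiso : ∀ j (w : Spec (.of (chartRing c j))), IsIso ((q j).stalkMap w))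

/-- The vertex prime of chart `0` as a point of `Spec B₀`. [folklore] -/
def vertexPoint : PrimeSpectrum (chartRing c 0) :=
  ⟨vertexIdeal c, (isMaximal_vertexIdeal c hz𝔪 hd).isPrime⟩

include hz𝔪 hJ in
omit [IsRegularLocalRing (X.presheaf.stalk z)] in
/-- The generators `c` generate the stalk of the centre. [folklore] -/
theorem span_eq_stalkIdeal_centre : Ideal.span (Set.range c) = stalkIdeal J z := by rw [hz𝔪, hJ]

include hqσ hz𝔪 hd hJ h𝓗 hG hσ hqiso in
/-- **The fibre over the vertex, (V): the NEW VERTEX.**  At the point `z' = q₀(vertex prime)` the weight-two transform of the host,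
the exceptional divisor and the weight-one transform of the old carrier read `((c'₁c'₂ + c'₃²), (c'₀), ⊤)` in a regular system of
parameters `c'` of the regular four-dimensional local ring `𝒪_{X',z'}`. [cite: StacksProject, Tag 0804] -/
theorem vertexFibre_vertex (x₀ : X') (hx₀ : q 0 (vertexPoint z c hz𝔪 hd) = x₀) :
    ∃ c' : Fin 4 → X'.presheaf.stalk x₀,
      IsRegularLocalRing (X'.presheaf.stalk x₀) ∧ Ideal.span (Set.range c') = maximalIdeal _ ∧
      (maximalIdeal (X'.presheaf.stalk x₀)).spanFinrank = 4 ∧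
      stalkIdeal (J.comap σ) x₀ = Ideal.span {c' 0} ∧
      stalkIdeal (controlledTransform σ J 𝓗 2) x₀ = Ideal.span {c' 1 * c' 2 + c' 3 ^ 2} ∧
      stalkIdeal (controlledTransform σ J G 1) x₀ = ⊤ := by
  classical
  have hc := span_eq_stalkIdeal_centre z c hz𝔪 hJ
  have hwv : (vertexPoint z c hz𝔪 hd).asIdeal.comap (chartBase c 0) = maximalIdeal _ := comap_vertexIdeal c hz𝔪 hd
  have hz₀ : σ x₀ = z := by rw [← hx₀]; exact apply_chart_eq_of_comap (hqσ 0) _ hwv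
  haveI := hqiso 0 (vertexPoint z c hz𝔪 hd)
  obtain ⟨χ, hχ, hloc, -⟩ := exists_stalk_presentation c 0 (q 0) (hqσ 0) (vertexPoint z c hz𝔪 hd) hx₀ hz₀
  letI : Algebra (chartRing c 0) (X'.presheaf.stalk x₀) := χ.toAlgebra
  haveI := hloc
  have hm := mem_vertexIdeal c
  haveI : (vertexPoint z c hz𝔪 hd).asIdeal.IsPrime := (vertexPoint z c hz𝔪 hd).isPrime
  obtain ⟨v, hv, hvspan, hv0, -, -, -, hvf⟩ :=
    coneVertex c hz𝔪 hd (vertexPoint z c hz𝔪 hd).asIdeal hwv (X'.presheaf.stalk x₀) hm.2.1 hm.2.2.1 hm.2.2.2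
  have hnzd : χ (chartBase c 0 (c 0)) ∈ nonZeroDivisors (X'.presheaf.stalk x₀) :=
    algebraMap_centre_mem_nonZeroDivisors c 0 (X'.presheaf.stalk x₀) (chartBase c 0)
      (reesChartBase_mem_nonZeroDivisors (c 0) (Ideal.mem_span_range_self (f := c) (x := 0))) (vertexPoint z c hz𝔪 hd).asIdeal
  refine ⟨v, hv.isRegularLocalRing, hvspan, ?_, ?_, ?_, ?_⟩
  · -- `μ(𝔪) = 4`
    obtain ⟨e, -, hde, -, -⟩ := hv.exists_rsop
    have hle : (maximalIdeal (X'.presheaf.stalk x₀)).spanFinrank ≤ 4 := by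
      rw [← hvspan, ← Set.image_univ]
      refine (Submodule.spanFinrank_span_le_ncard_of_finite (Set.toFinite _)).trans ?_
      refine (Set.ncard_image_le (Set.toFinite _)).trans ?_
      rw [Set.ncard_univ, Nat.card_eq_fintype_card, Fintype.card_fin]
    omega
  · rw [stalkIdeal_exceptional_of_presentation χ hz₀ hχ hc, hv0]; rfl
  · rw [stalkIdeal_controlledTransform_of_presentation χ hz₀ hχ hσ hc hnzd 𝓗 _ h𝓗 2 (coneFun c 0) ?_]
    · have hvf' : χ (coneFun c 0) = v 1 * v 2 + v 3 ^ 2 := hvf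
      rw [hvf']
    · rw [chartBase_cone c 0, map_mul, map_pow]
  · have h1 : chartGen c 0 0 = 1 := chartGen_self c 0
    rw [stalkIdeal_controlledTransform_of_presentation χ hz₀ hχ hσ hc hnzd G _ hG 1 (chartGen c 0 0) ?_]
    · rw [h1, map_one, Ideal.span_singleton_one]
    · rw [h1, map_one, mul_one, pow_one]

include hσ hz𝔪 hJ h𝓗 hG hqσ hqiso in
omit [IsRegularLocalRing (X.presheaf.stalk z)] in
/-- **Presentation of a point of the fibre on chart `j`**: `𝒪_{X',x'}` is the localisation of `B_j` at `w`, `w ∩ 𝒪_{X,z} = 𝔪_z`,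
and the three ideals of interest have the stalks `(φ c_j)`, `(f_j)` (strict transform of the cone) and `(e₀)` (strict transform of
the old carrier `c₀`). [cite: StacksProject, Tag 0804] -/
theorem offVertex_presentation (j : Fin 4) (w : PrimeSpectrum (chartRing c j)) (x' : X') (hx' : q j w = x') (hz' : σ x' = z) :
    ∃ χ : chartRing c j →+* X'.presheaf.stalk x',
      @IsLocalization.AtPrime _ _ (X'.presheaf.stalk x') _ χ.toAlgebra w.asIdeal _ ∧
      w.asIdeal.comap (chartBase c j) = maximalIdeal (X.presheaf.stalk z) ∧
      stalkIdeal (J.comap σ) x' = Ideal.span {χ (chartBase c j (c j))} ∧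
      stalkIdeal (controlledTransform σ J 𝓗 2) x' = Ideal.span {χ (coneFun c j)} ∧
      stalkIdeal (controlledTransform σ J G 1) x' = Ideal.span {χ (chartGen c j 0)} := by
  classical
  have hc := span_eq_stalkIdeal_centre z c hz𝔪 hJ
  haveI := hqiso j w
  obtain ⟨χ, hχ, hloc, hw𝔪⟩ := exists_stalk_presentation c j (q j) (hqσ j) w hx' hz'
  letI : Algebra (chartRing c j) (X'.presheaf.stalk x') := χ.toAlgebra
  haveI := hloc
  have hnzd : χ (chartBase c j (c j)) ∈ nonZeroDivisors (X'.presheaf.stalk x') :=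
    algebraMap_centre_mem_nonZeroDivisors c j (X'.presheaf.stalk x') (chartBase c j)
      (reesChartBase_mem_nonZeroDivisors (c j) (Ideal.mem_span_range_self (f := c) (x := j))) w.asIdeal
  refine ⟨χ, hloc, hw𝔪, stalkIdeal_exceptional_of_presentation χ hz' hχ hc, ?_, ?_⟩
  · exact stalkIdeal_controlledTransform_of_presentation χ hz' hχ hσ hc hnzd 𝓗 _ h𝓗 2 (coneFun c j)
      (by rw [chartBase_cone c j, map_mul, map_pow])
  · exact stalkIdeal_controlledTransform_of_presentation χ hz' hχ hσ hc hnzd G _ hG 1 (chartGen c j 0)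
      (by rw [reesChartBase_apply_eq_mul_chartGen c j 0, map_mul, pow_one])

/-- Membership in a support from a principal stalk: `x' ∈ supp D` and `D_{x'} = (χ g)` with `𝒪_{X',x'} = (B_j)_w` force `g ∈ w`.
[folklore] -/
theorem mem_of_mem_support {A : Type u} [CommRing A] {x' : X'} (χ : A →+* X'.presheaf.stalk x') (𝔓 : Ideal A) [𝔓.IsPrime]
    (hloc : @IsLocalization.AtPrime _ _ (X'.presheaf.stalk x') _ χ.toAlgebra 𝔓 _) {D : X'.IdealSheafData} {g : A}
    (hD : stalkIdeal D x' = Ideal.span {χ g}) (hx : x' ∈ D.support) : g ∈ 𝔓 := by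
  letI : Algebra A (X'.presheaf.stalk x') := χ.toAlgebra
  haveI : IsLocalRing (X'.presheaf.stalk x') := inferInstance
  have hle : stalkIdeal D x' ≤ maximalIdeal _ := (mem_support_iff_stalkIdeal_le D x').mp hx
  rw [hD, Ideal.span_singleton_le_iff_mem] at hle
  have := (IsLocalization.AtPrime.to_map_mem_maximal_iff (X'.presheaf.stalk x') 𝔓 g).mp hle
  exact this

include hσ hz𝔪 hd hJ h𝓗 hG hqσ hqiso in
/-- **The fibre of the vertex, chart `0`, off the vertex**: the strict transform of the cone, the exceptional divisor and the strict
transform of the old carrier `c₀` (which is empty on this chart) have simple normal crossings. [cite: Kollar2007, Def. 3.24] -/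
theorem sncWithAt_chart_zero (w : PrimeSpectrum (chartRing c 0)) (x' : X') (hx' : q 0 w = x') (hz' : σ x' = z)
    (hne : x' ≠ q 0 (vertexPoint z c hz𝔪 hd)) :
    DepthSNC.SNCWithAt [controlledTransform σ J 𝓗 2, J.comap σ, controlledTransform σ J G 1] ⊤ x' := by
  classical
  obtain ⟨χ, hloc, hw𝔪, hstE, hstH, hstG⟩ := offVertex_presentation hσ z c hz𝔪 hJ 𝓗 G h𝓗 hG q hqσ hqiso 0 w x' hx' hz'
  letI : Algebra (chartRing c 0) (X'.presheaf.stalk x') := χ.toAlgebra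
  haveI := hloc
  -- `x'` is not the vertex, so not all of `e₁, e₂, e₃` lie in `w`
  have hnv : ¬ (chartGen c 0 1 ∈ w.asIdeal ∧ chartGen c 0 2 ∈ w.asIdeal ∧ chartGen c 0 3 ∈ w.asIdeal) := by
    rintro ⟨h1, h2, h3⟩
    have hw : w.asIdeal = vertexIdeal c := eq_vertexIdeal c hz𝔪 hd w.asIdeal hw𝔪 h1 h2 h3
    have hwv : w = vertexPoint z c hz𝔪 hd := PrimeSpectrum.ext hw
    exact hne (by rw [← hx', hwv])
  -- the old carrier is empty on this chart: `e₀ = 1`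
  have hG' : x' ∉ (controlledTransform σ J G 1).support := by
    intro hx
    have h1 : chartGen c 0 0 = 1 := chartGen_self c 0
    have hmem := mem_of_mem_support χ w.asIdeal hloc hstG hx
    rw [h1] at hmem
    exact w.isPrime.ne_top ((Ideal.eq_top_iff_one _).mpr hmem)
  have key : DepthSNC.SNCWithAt ([(J.comap σ, chartBase c 0 (c 0)), (controlledTransform σ J 𝓗 2, coneFun c 0)].map Prod.fst)
      ⊤ x' := by
    refine sncWithAt_of_adapted χ w.asIdeal hloc _ ?_ ?_ ?_
    · intro p hp
      simp only [List.mem_cons, List.not_mem_nil, or_false] at hp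
      rcases hp with rfl | rfl
      · exact hstE
      · exact hstH
    · intro p hp p' hp' h
      simp only [List.mem_cons, List.not_mem_nil, or_false] at hp hp'
      have hne' := coneFun_ne_chartBase_zero c hz𝔪 hd
      rcases hp with rfl | rfl <;> rcases hp' with rfl | rfl
      · rfl
      · exact absurd h.symm hne'
      · exact absurd h hne'
      · rfl
    · exact coneChart_zero c hz𝔪 hd w.asIdeal hw𝔪 (X'.presheaf.stalk x') hnv
  refine key.anti fun D hD hxD => ?_
  simp only [List.mem_cons, List.not_mem_nil, or_false] at hD
  simp only [List.map_cons, List.map_nil, List.mem_cons, List.not_mem_nil, or_false]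
  rcases hD with rfl | rfl | rfl
  · exact Or.inr rfl
  · exact Or.inl rfl
  · exact absurd hxD hG'

include hσ hz𝔪 hd hJ h𝓗 hG hqσ hqiso in
/-- **The fibre of the vertex, charts `1` and `2`**: the strict transform of the cone (a graph over the `e_k`-axis), the exceptional
divisor and the strict transform of the old carrier have simple normal crossings. [cite: Kollar2007, Def. 3.24] -/
theorem sncWithAt_chart_linear (i k : Fin 4) (hi0 : i ≠ 0) (hk0 : k ≠ 0) (hki : k ≠ i) (hk3 : k ≠ 3) (hi3 : (3 : Fin 4) ≠ i)
    (hcone : Ideal.Quotient.mk (Ideal.span {chartBase c i (c i)}) (coneFun c i) =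
      Ideal.Quotient.mk (Ideal.span {chartBase c i (c i)}) (chartGen c i k) +
        Ideal.Quotient.mk (Ideal.span {chartBase c i (c i)}) (chartGen c i 3) ^ 2)
    (w : PrimeSpectrum (chartRing c i)) (x' : X') (hx' : q i w = x') (hz' : σ x' = z) :
    DepthSNC.SNCWithAt [controlledTransform σ J 𝓗 2, J.comap σ, controlledTransform σ J G 1] ⊤ x' := by
  classical
  obtain ⟨χ, hloc, hw𝔪, hstE, hstH, hstG⟩ := offVertex_presentation hσ z c hz𝔪 hJ 𝓗 G h𝓗 hG q hqσ hqiso i w x' hx' hz'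
  letI : Algebra (chartRing c i) (X'.presheaf.stalk x') := χ.toAlgebra
  haveI := hloc
  obtain ⟨hn1, hn2, hn3⟩ := coneFun_ne_linear c hz𝔪 hd i k hi0.symm hki hk3 hi3 hk0 hcone
  have key : DepthSNC.SNCWithAt ([(J.comap σ, chartBase c i (c i)), (controlledTransform σ J G 1, chartGen c i 0),
      (controlledTransform σ J 𝓗 2, coneFun c i)].map Prod.fst) ⊤ x' := by
    refine sncWithAt_of_adapted χ w.asIdeal hloc _ ?_ ?_ ?_
    · intro p hp
      simp only [List.mem_cons, List.not_mem_nil, or_false] at hp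
      rcases hp with rfl | rfl | rfl
      · exact hstE
      · exact hstG
      · exact hstH
    · intro p hp p' hp' h
      simp only [List.mem_cons, List.not_mem_nil, or_false] at hp hp'
      rcases hp with rfl | rfl | rfl <;> rcases hp' with rfl | rfl | rfl
      · rfl
      · exact absurd h.symm hn3
      · exact absurd h.symm hn1
      · exact absurd h hn3
      · rfl
      · exact absurd h.symm hn2
      · exact absurd h hn1
      · exact absurd h hn2
      · rfl
    · exact coneChart_linear c hz𝔪 hd i w.asIdeal hw𝔪 (X'.presheaf.stalk x') k hi0 hk0 hki hk3 hi3 hcone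
  refine key.anti fun D hD _ => ?_
  simp only [List.mem_cons, List.not_mem_nil, or_false] at hD
  simp only [List.map_cons, List.map_nil, List.mem_cons, List.not_mem_nil, or_false]
  rcases hD with rfl | rfl | rfl
  · exact Or.inr (Or.inr rfl)
  · exact Or.inl rfl
  · exact Or.inr (Or.inl rfl)

include hσ hz𝔪 hd hJ h𝓗 hG hqσ hqiso in
/-- **The fibre of the vertex, chart `3`**: the strict transform of the cone (`e₁e₂ + 1`), the exceptional divisor and the strict
transform of the old carrier have simple normal crossings. [cite: Kollar2007, Def. 3.24] -/
theorem sncWithAt_chart_three (w : PrimeSpectrum (chartRing c 3)) (x' : X') (hx' : q 3 w = x') (hz' : σ x' = z) :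
    DepthSNC.SNCWithAt [controlledTransform σ J 𝓗 2, J.comap σ, controlledTransform σ J G 1] ⊤ x' := by
  classical
  obtain ⟨χ, hloc, hw𝔪, hstE, hstH, hstG⟩ := offVertex_presentation hσ z c hz𝔪 hJ 𝓗 G h𝓗 hG q hqσ hqiso 3 w x' hx' hz'
  letI : Algebra (chartRing c 3) (X'.presheaf.stalk x') := χ.toAlgebra
  haveI := hloc
  obtain ⟨hn1, hn2, hn3⟩ := coneFun_ne_three c hz𝔪 hd
  have key : DepthSNC.SNCWithAt ([(J.comap σ, chartBase c 3 (c 3)), (controlledTransform σ J G 1, chartGen c 3 0),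
      (controlledTransform σ J 𝓗 2, coneFun c 3)].map Prod.fst) ⊤ x' := by
    refine sncWithAt_of_adapted χ w.asIdeal hloc _ ?_ ?_ ?_
    · intro p hp
      simp only [List.mem_cons, List.not_mem_nil, or_false] at hp
      rcases hp with rfl | rfl | rfl
      · exact hstE
      · exact hstG
      · exact hstH
    · intro p hp p' hp' h
      simp only [List.mem_cons, List.not_mem_nil, or_false] at hp hp'
      rcases hp with rfl | rfl | rfl <;> rcases hp' with rfl | rfl | rfl
      · rfl
      · exact absurd h.symm hn3
      · exact absurd h.symm hn1
      · exact absurd h hn3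
      · rfl
      · exact absurd h.symm hn2
      · exact absurd h hn1
      · exact absurd h hn2
      · rfl
    · exact coneChart_three c hz𝔪 hd w.asIdeal hw𝔪 (X'.presheaf.stalk x')
  refine key.anti fun D hD _ => ?_
  simp only [List.mem_cons, List.not_mem_nil, or_false] at hD
  simp only [List.map_cons, List.map_nil, List.mem_cons, List.not_mem_nil, or_false]
  rcases hD with rfl | rfl | rfl
  · exact Or.inr (Or.inr rfl)
  · exact Or.inl rfl
  · exact Or.inr (Or.inl rfl)

include hσ hz𝔪 hd hJ h𝓗 hG in
/-- **THE VERTEX FIBRE THEOREM.**  Blow up a regular scheme `X` along an ideal `J` whose stalk at the point `z` is the maximal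
ideal, `𝒪_{X,z}` regular of dimension `4` with regular system of parameters `c₀, …, c₃`, and follow the quadric cone
`𝓗_z = (c₁c₂ + c₃²)` and the carrier `G_z = (c₀)`.  Over `z` there is exactly one bad point `z'` (the new vertex): at `z'` the
local ring is regular of dimension `4` with a regular system of parameters `c'` in which the exceptional divisor is `(c'₀)`, the
weight-`2` controlled transform of `𝓗` is again the cone `(c'₁c'₂ + c'₃²)` and the strict transform of `G` is empty; at every
other point over `z` the three ideals (cone transform, exceptional divisor, transform of `G`) have simple normal crossings.
[cite: Kollar2007, §3.61 (resolving the pinch point / quadric cone by blowing up the vertex)] [cite: StacksProject, Tag 0804] -/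
theorem vertex_fibre :
    ∃ z' : X', σ z' = z ∧
      (∃ c' : Fin 4 → X'.presheaf.stalk z',
        IsRegularLocalRing (X'.presheaf.stalk z') ∧ Ideal.span (Set.range c') = maximalIdeal _ ∧
        (maximalIdeal (X'.presheaf.stalk z')).spanFinrank = 4 ∧
        stalkIdeal (J.comap σ) z' = Ideal.span {c' 0} ∧
        stalkIdeal (controlledTransform σ J 𝓗 2) z' = Ideal.span {c' 1 * c' 2 + c' 3 ^ 2} ∧
        stalkIdeal (controlledTransform σ J G 1) z' = ⊤) ∧
      ∀ x' : X', σ x' = z → x' ≠ z' →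
        DepthSNC.SNCWithAt [controlledTransform σ J 𝓗 2, J.comap σ, controlledTransform σ J G 1] ⊤ x' := by
  classical
  obtain ⟨q, hqσ, hqiso, hcov⟩ := exists_charts_over hσ z c (span_eq_stalkIdeal_centre z c hz𝔪 hJ)
  refine ⟨q 0 (vertexPoint z c hz𝔪 hd), ?_, vertexFibre_vertex hσ z c hz𝔪 hd hJ 𝓗 G h𝓗 hG q hqσ hqiso _ rfl, ?_⟩
  · exact apply_chart_eq_of_comap (hqσ 0) _ (comap_vertexIdeal c hz𝔪 hd)
  · intro x' hx' hne
    obtain ⟨j, w, hqw⟩ := hcov x' hx'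
    fin_cases j
    · exact sncWithAt_chart_zero hσ z c hz𝔪 hd hJ 𝓗 G h𝓗 hG q hqσ hqiso w x' hqw hx' hne
    · exact sncWithAt_chart_linear hσ z c hz𝔪 hd hJ 𝓗 G h𝓗 hG q hqσ hqiso 1 2 (by decide) (by decide) (by decide)
        (by decide) (by decide) (mk_coneFun_one c) w x' hqw hx'
    · exact sncWithAt_chart_linear hσ z c hz𝔪 hd hJ 𝓗 G h𝓗 hG q hqσ hqiso 2 1 (by decide) (by decide) (by decide)
        (by decide) (by decide) (mk_coneFun_two c) w x' hqw hx'
    · exact sncWithAt_chart_three hσ z c hz𝔪 hd hJ 𝓗 G h𝓗 hG q hqσ hqiso w x' hqw hx'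

end VertexFibre

end ConeDepth

end Summit.ResolutionOfSingularities.ResolutionOfSingularities.Theorems

end
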